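import Summits.ValiantsHypothesis.ValiantsHypothesis.Theorems.LacunarySymmetroidMatrixDescartesCensusAltChainLift

/-!
# `MatrixDescartes` census — the HIERARCHICAL LIFTING LEMMA (part 2): a boundary seventeen lifts to a twenty on the same support

HONEST FRAMING.  Object-search cell `pub-symmetroid`, crux `Theses.LacunarySymmetroid.MatrixDescartes`
(stmt-ValiantsHypothesis-18050); this file is a HELPER of that item with no closure claim.  With the polynomial lifting
steps of `…CensusAltChainLift` (part 1) it types and proves the elementary perturbation statement §2(g) of the theory
seat's RESIDUE-READING note (theory g20, 2026-08-25; typer duty W1 of the desk's ruling R1260): on the boundary stratum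
`F₀(d)` of the V = 20 programme for `DoorA26 = PosRootLawAt 2 6 19` (OPEN, never asserted) — letters
`S₀ = (S₀)₀₀·e₁e₁ᵀ` with `(S₀)₀₀ ≠ 0`, `(S₁)₁₁ = (S₂)₁₁ = 0` — a determinant with an alternation chain of `18` positive
points (e.g. `17` simple positive roots certified by signs at `18` rational points) LIFTS, by switching on the three
vanishing low coefficients with hierarchically small alternating perturbations along `e₂e₂ᵀ`, to a real symmetric pencil
ON THE SAME SUPPORT with `≥ 20` distinct positive roots (`twenty_of_boundary_seventeen`).  Read contrapositively: a
kernel proof of the support row `PosRootLawOn 2 6 19 d` excludes boundary seventeens on `F₀(d)`.  NOTHING here asserts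
that such boundary forms exist or do not exist; nothing bounds `ζ`; nothing bears on `MatrixDescartes` or on `VP ≠ VNP`.

Contents (all PROVED): `E22`, `pencil2`, `pencil2_apply`, `det_pencil2_perturb` — the `2 × 2`-PENCIL REALISATION:
perturbing every letter along `E₂₂ = e₂e₂ᵀ`, `S_l ↦ S_l + ψ_l E₂₂`, changes `det` by `(∑_l ψ_l X^{d_l}) · m₀₀`
(rank-one update, LINEAR in `ψ`; `m₀₀` = the `(0,0)` entry of the pencil); `lift_three_on_support` (chain of length
`N + 1` for the determinant, `(S₀)₀₀ ≠ 0`, coefficients vanishing through order `d₂` ⇒ a symmetric pencil on the same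
`d` with `≥ N + 3` distinct positive roots); `boundaryF0_coeff_eq_zero` (on `F₀(d)` every coefficient of order
`< min(d₃, 2d₁)` vanishes: `X^{d₃} ∣ A₁₁`, `X^{2d₁} ∣ A₀₁A₁₀`); `twenty_of_boundary_seventeen` — the headline corollary
for `0 = d₀ < d₁ < d₂ < ⋯` with `d₂ < 2d₁` (every OPEN-core support of record, e.g. `(0,2,3,7,16,27)`, `(0,3,4,9,19,32)`).

[folklore] Elementary; no citation exists or is needed.
-/

-- `Summit.ValiantsHypothesis.ValiantsHypothesis.…` repeats a component by the D-0017 layout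
-- (single-conjunct summit), which the `dupNamespace` linter flags; the name is mandated.
set_option linter.dupNamespace false

open Polynomial Finset
open scoped BigOperators Polynomial

namespace Summit.ValiantsHypothesis.ValiantsHypothesis.Theorems.LacunarySymmetroidMatrixDescartes.Census

/-! ## Robustness of alternation chains (the «bump condition» currency of RESIDUE-READING §2(l3)) -/

/-- **An alternation chain survives any perturbation that is smaller than `|f|` at the chain points**: if
`|h(aᵢ)| < |f(aᵢ)|` for every point of an alternation chain of `f`, then `f + h` has the same chain (hence at least as
many distinct positive roots between `a₀` and `a_N`).  This is the exact form of the «bump condition» under which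
removing / adding low-order terms keeps the root count certified by signs. [folklore] -/
theorem altChain_add_of_abs_lt {f h : ℝ[X]} {N : ℕ} {s : ℝ} {a : Fin (N + 1) → ℝ} (hc : AltChain f N s a)
    (hsmall : ∀ i, |h.eval (a i)| < |f.eval (a i)|) : AltChain (f + h) N s a := by
  obtain ⟨hmono, ha0, halt, hanc⟩ := hc
  have hkeep : ∀ i, 0 < f.eval (a i) * (f + h).eval (a i) := by
    intro i
    have h1 := hsmall i
    have hfnz : f.eval (a i) ≠ 0 := by
      intro h0; rw [h0, abs_zero] at h1; exact (abs_nonneg _).not_gt h1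
    have h2 : -(|h.eval (a i)| * |f.eval (a i)|) ≤ h.eval (a i) * f.eval (a i) := by
      rw [← abs_mul]; exact neg_abs_le _
    have h3 : 0 < |f.eval (a i)| * (|f.eval (a i)| - |h.eval (a i)|) :=
      mul_pos (abs_pos.mpr hfnz) (sub_pos.mpr h1)
    have h4 : f.eval (a i) * (f + h).eval (a i) = f.eval (a i) ^ 2 + h.eval (a i) * f.eval (a i) := by
      simp only [eval_add]; ring
    rw [h4]; nlinarith [sq_abs (f.eval (a i))]
  refine ⟨hmono, ha0, fun i => mul_neg_of_sign_transfer (hkeep _) (hkeep _) (halt i), ?_⟩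
  have := hkeep 0
  by_contra hcon
  push Not at hcon
  nlinarith [mul_pos hanc this, sq_nonneg (f.eval (a 0))]

/-- Corollary in root-count currency: under the bump condition `|h(aᵢ)| < |f(aᵢ)|` on a chain of `N + 1` positive points
of `f`, the polynomial `f + h` has at least `N` distinct positive roots. [folklore] -/
theorem le_card_posRoots_add_of_abs_lt {f h : ℝ[X]} {N : ℕ} {s : ℝ} {a : Fin (N + 1) → ℝ} (hc : AltChain f N s a)
    (hsmall : ∀ i, |h.eval (a i)| < |f.eval (a i)|) :
    N ≤ ((f + h).roots.toFinset.filter (fun t => 0 < t)).card :=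
  le_card_posRoots_of_altChain (altChain_add_of_abs_lt hc hsmall)

/-! ## The `2 × 2`-pencil realisation of the perturbation (rank-one updates along `e₂ e₂ᵀ`) -/

/-- the matrix unit `E₂₂ = e₂ e₂ᵀ` [definition of the cell] -/
def E22 : Matrix (Fin 2) (Fin 2) ℝ := !![0, 0; 0, 1]

/-- `E₂₂` is symmetric. [folklore] -/
theorem E22_isSymm : E22.IsSymm := by
  unfold E22; ext i j; fin_cases i <;> fin_cases j <;> rfl

/-- entry `(0,0)` of `E₂₂`. [folklore] -/
@[simp] theorem E22_apply_00 : E22 0 0 = 0 := by simp [E22]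
/-- entry `(0,1)` of `E₂₂`. [folklore] -/
@[simp] theorem E22_apply_01 : E22 0 1 = 0 := by simp [E22]
/-- entry `(1,0)` of `E₂₂`. [folklore] -/
@[simp] theorem E22_apply_10 : E22 1 0 = 0 := by simp [E22]
/-- entry `(1,1)` of `E₂₂`. [folklore] -/
@[simp] theorem E22_apply_11 : E22 1 1 = 1 := by simp [E22]

/-- The symmetric `2 × 2` pencil on exponents `d` with letters `S`. [definition of the cell] -/
noncomputable def pencil2 {K : ℕ} (d : Fin K → ℕ) (S : Fin K → Matrix (Fin 2) (Fin 2) ℝ) :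
    Matrix (Fin 2) (Fin 2) ℝ[X] :=
  ∑ l, (X : ℝ[X]) ^ d l • (S l).map C

/-- entries of the pencil: `(pencil2 d S) i j = ∑_l X^{d_l} · C ((S_l) i j)`. [folklore] -/
theorem pencil2_apply {K : ℕ} (d : Fin K → ℕ) (S : Fin K → Matrix (Fin 2) (Fin 2) ℝ) (i j : Fin 2) :
    pencil2 d S i j = ∑ l, (X : ℝ[X]) ^ d l * C ((S l) i j) := by
  unfold pencil2
  simp [Matrix.sum_apply, Matrix.smul_apply, Matrix.map_apply, smul_eq_mul]

/-- **Pencil realisation**: `det (pencil2 d (S + ψ·E₂₂)) = det (pencil2 d S) + (∑_l X^{d_l} C(ψ_l)) · m₀₀` — the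
rank-one update along `E₂₂` is LINEAR in `ψ` (no mixed terms). [folklore] -/
theorem det_pencil2_perturb {K : ℕ} (d : Fin K → ℕ) (S : Fin K → Matrix (Fin 2) (Fin 2) ℝ) (ψ : Fin K → ℝ) :
    (pencil2 d (fun l => S l + ψ l • E22)).det
      = (pencil2 d S).det + (∑ l, (X : ℝ[X]) ^ d l * C (ψ l)) * (∑ l, (X : ℝ[X]) ^ d l * C ((S l) 0 0)) := by
  rw [Matrix.det_fin_two, Matrix.det_fin_two]
  simp only [pencil2_apply, Matrix.add_apply, Matrix.smul_apply, smul_eq_mul, E22_apply_00, E22_apply_01,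
    E22_apply_10, E22_apply_11, mul_zero, add_zero, mul_one, map_add, mul_add, Finset.sum_add_distrib]
  ring


/-- perturbing symmetric letters along `E₂₂` keeps them symmetric. [folklore] -/
theorem pencil2_perturb_isSymm {K : ℕ} (S : Fin K → Matrix (Fin 2) (Fin 2) ℝ) (hS : ∀ l, (S l).IsSymm)
    (ψ : Fin K → ℝ) (l : Fin K) : (S l + ψ l • E22).IsSymm :=
  (hS l).add (E22_isSymm.smul _)

/-! ## The boundary stratum `F₀(d)` and the headline corollary -/

/-- The `(0,0)` entry of the pencil: `m₀₀ = ∑_l X^{d_l} (S_l)₀₀`. [definition of the cell] -/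
noncomputable def m00 {K : ℕ} (d : Fin K → ℕ) (S : Fin K → Matrix (Fin 2) (Fin 2) ℝ) : ℝ[X] :=
  ∑ l, (X : ℝ[X]) ^ d l * C ((S l) 0 0)

/-- on sorted exponents with `d₀ = 0`, the constant term of `m₀₀` is `(S₀)₀₀`. [folklore] -/
theorem m00_coeff_zero (d : Fin 6 → ℕ) (hd : StrictMono d) (hd0 : d 0 = 0)
    (S : Fin 6 → Matrix (Fin 2) (Fin 2) ℝ) : (m00 d S).coeff 0 = (S 0) 0 0 := by
  unfold m00
  rw [finsetSum_coeff, Finset.sum_eq_single (0 : Fin 6)]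
  · simp [hd0]
  · intro l _ hl
    have hdl : 0 < d l := by
      have := hd (Fin.pos_iff_ne_zero.mpr hl)
      rw [hd0] at this; exact this
    rw [coeff_X_pow_mul']
    simp [Nat.pos_iff_ne_zero.mp hdl]
  · intro h; exact absurd (mem_univ _) h

/-- `X^n · m₀₀` has no coefficient below order `n`. [folklore] -/
theorem coeff_X_pow_mul_m00_lt {K : ℕ} (d : Fin K → ℕ) (S : Fin K → Matrix (Fin 2) (Fin 2) ℝ) (n k : ℕ)
    (hk : k < n) : ((X : ℝ[X]) ^ n * m00 d S).coeff k = 0 := by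
  rw [coeff_X_pow_mul']; simp [not_le.mpr hk]

/-- the order-`n` coefficient of `X^n · m₀₀` is the constant term of `m₀₀`. [folklore] -/
theorem coeff_X_pow_mul_m00_self {K : ℕ} (d : Fin K → ℕ) (S : Fin K → Matrix (Fin 2) (Fin 2) ℝ) (n : ℕ) :
    ((X : ℝ[X]) ^ n * m00 d S).coeff n = (m00 d S).coeff 0 := by
  rw [coeff_X_pow_mul']; simp

/-- **LIFTING ON A SUPPORT (general chain length).**  On exponents `0 = d₀ < d₁ < ⋯` and letters `S` with `(S₀)₀₀ ≠ 0`,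
if the determinant `f₀` of the pencil vanishes to order `> d₂` at `0` and carries an alternation chain of length `N + 1`
on positive points, then perturbing the three lowest letters along `E₂₂` (`S_l ↦ S_l + ψ_l E₂₂`, `l = 0,1,2`, `ψ`
hierarchically small with alternating signs) gives a symmetric pencil ON THE SAME SUPPORT with at least `N + 3` distinct
positive roots. [folklore] -/
theorem lift_three_on_support (d : Fin 6 → ℕ) (hd : StrictMono d) (hd0 : d 0 = 0)
    (S : Fin 6 → Matrix (Fin 2) (Fin 2) ℝ) (h00 : (S 0) 0 0 ≠ 0)
    (hlow : ∀ k ≤ d 2, (pencil2 d S).det.coeff k = 0)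
    (N : ℕ) (s : ℝ) (a : Fin (N + 1) → ℝ) (hchain : AltChain (pencil2 d S).det N s a) :
    ∃ ψ : Fin 6 → ℝ, N + 3 ≤ ((pencil2 d (fun l => S l + ψ l • E22)).det.roots.toFinset.filter
      (fun t => 0 < t)).card := by
  have hm : (m00 d S).coeff 0 ≠ 0 := by rw [m00_coeff_zero d hd hd0 S]; exact h00
  have h01 : d 0 < d 1 := hd (by decide)
  have h12 : d 1 < d 2 := hd (by decide)
  obtain ⟨η₂, η₁, η₀, s', a', hch⟩ := altChain_lift_three (pencil2 d S).det
    (X ^ d 2 * m00 d S) (X ^ d 1 * m00 d S) (X ^ d 0 * m00 d S) (d 0) (d 1) (d 2) h01 h12 hlow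
    (coeff_X_pow_mul_m00_lt d S (d 2)) (by rw [coeff_X_pow_mul_m00_self]; exact hm)
    (coeff_X_pow_mul_m00_lt d S (d 1)) (by rw [coeff_X_pow_mul_m00_self]; exact hm)
    (coeff_X_pow_mul_m00_lt d S (d 0)) (by rw [coeff_X_pow_mul_m00_self]; exact hm)
    N s a hchain
  refine ⟨![η₀, η₁, η₂, 0, 0, 0], ?_⟩
  have hdet : (pencil2 d (fun l => S l + (![η₀, η₁, η₂, 0, 0, 0] : Fin 6 → ℝ) l • E22)).det
      = (pencil2 d S).det + C η₂ * (X ^ d 2 * m00 d S) + C η₁ * (X ^ d 1 * m00 d S)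
        + C η₀ * (X ^ d 0 * m00 d S) := by
    rw [det_pencil2_perturb]
    have hΦ : (∑ l, (X : ℝ[X]) ^ d l * C ((![η₀, η₁, η₂, 0, 0, 0] : Fin 6 → ℝ) l))
        = X ^ d 0 * C η₀ + X ^ d 1 * C η₁ + X ^ d 2 * C η₂ := by
      simp [Fin.sum_univ_six]
    rw [hΦ]; unfold m00; ring
  rw [hdet]
  exact le_card_posRoots_of_altChain hch

/-- **BOUNDARY STRATUM `F₀(d)` ⇒ low coefficients vanish.**  If `S₀ = (S₀)₀₀ · e₁e₁ᵀ` (`(S₀)₀₁ = (S₀)₁₁ = 0`) and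
`(S₁)₁₁ = (S₂)₁₁ = 0`, then `X^{min(d₃, 2d₁)}` divides the determinant of the pencil: every coefficient of order `< d₃`
and `< 2 d₁` vanishes. [folklore] -/
theorem boundaryF0_coeff_eq_zero (d : Fin 6 → ℕ) (hd : StrictMono d)
    (S : Fin 6 → Matrix (Fin 2) (Fin 2) ℝ) (hS : ∀ l, (S l).IsSymm)
    (h01 : (S 0) 0 1 = 0) (h11 : ∀ l : Fin 6, l ≤ 2 → (S l) 1 1 = 0)
    (k : ℕ) (hk3 : k < d 3) (hk1 : k < 2 * d 1) : (pencil2 d S).det.coeff k = 0 := by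
  -- entries
  have hA11 : (X : ℝ[X]) ^ d 3 ∣ pencil2 d S 1 1 := by
    rw [pencil2_apply]
    apply Finset.dvd_sum
    intro l _
    by_cases hl : l ≤ 2
    · rw [h11 l hl, map_zero, mul_zero]; exact dvd_zero _
    · have h3l : d 3 ≤ d l := hd.monotone (by
        have : (3 : Fin 6) ≤ l := by
          rcases l with ⟨l, hl'⟩
          simp only [Fin.le_def] at hl ⊢
          simp at hl ⊢; omega
        exact this)
      exact Dvd.dvd.mul_right (pow_dvd_pow X h3l) _
  have hA01 : (X : ℝ[X]) ^ d 1 ∣ pencil2 d S 0 1 := by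
    rw [pencil2_apply]
    apply Finset.dvd_sum
    intro l _
    by_cases hl : l = 0
    · subst hl; rw [h01, map_zero, mul_zero]; exact dvd_zero _
    · have h1l : d 1 ≤ d l := hd.monotone (by
        have : (1 : Fin 6) ≤ l := by
          rcases l with ⟨l, hl'⟩
          simp only [Fin.le_def]
          have : l ≠ 0 := fun h => hl (by ext; simpa using h)
          simp; omega
        exact this)
      exact Dvd.dvd.mul_right (pow_dvd_pow X h1l) _
  have hA10 : (X : ℝ[X]) ^ d 1 ∣ pencil2 d S 1 0 := by
    have : pencil2 d S 1 0 = pencil2 d S 0 1 := by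
      rw [pencil2_apply, pencil2_apply]
      apply Finset.sum_congr rfl; intro l _
      rw [show (S l) 1 0 = (S l) 0 1 from by
        have := (hS l).apply 0 1; exact this]
    rw [this]; exact hA01
  rw [Matrix.det_fin_two]
  rw [coeff_sub]
  have h1 : ((pencil2 d S 0 0) * (pencil2 d S 1 1)).coeff k = 0 := by
    obtain ⟨u, hu⟩ := hA11
    rw [hu, ← mul_assoc, mul_comm (pencil2 d S 0 0), mul_assoc, coeff_X_pow_mul']
    simp [not_le.mpr hk3]
  have h2 : ((pencil2 d S 0 1) * (pencil2 d S 1 0)).coeff k = 0 := by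
    obtain ⟨u, hu⟩ := hA01
    obtain ⟨v, hv⟩ := hA10
    rw [hu, hv, show (X : ℝ[X]) ^ d 1 * u * (X ^ d 1 * v) = X ^ (2 * d 1) * (u * v) by ring, coeff_X_pow_mul']
    simp [not_le.mpr hk1]
  rw [h1, h2, sub_zero]

/-- **RESIDUE-READING §2(g), kernel form — a boundary seventeen lifts to a twenty on the same support.**  Let
`0 = d₀ < d₁ < d₂ < ⋯ < d₅` with `d₂ < 2 d₁`, and let `S` be real symmetric letters ON THE BOUNDARY STRATUM `F₀(d)`:
`S₀ = (S₀)₀₀ · e₁e₁ᵀ` with `(S₀)₀₀ ≠ 0`, and `(S₁)₁₁ = (S₂)₁₁ = 0`.  If the determinant of the pencil carries an alternation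
chain of `18` positive points (e.g. `17` simple positive roots certified by signs at `18` rational points), then some real
symmetric `2 × 2` pencil on the SAME exponents `d` has at least `20` distinct positive roots — i.e. `d` would refute
`PosRootLawOn 2 6 19 d` (row currency of …CensusDefs, stated here unfolded).  Nothing is asserted about the existence of
such boundary forms. [folklore] -/
theorem twenty_of_boundary_seventeen (d : Fin 6 → ℕ) (hd : StrictMono d) (hd0 : d 0 = 0) (h21 : d 2 < 2 * d 1)
    (S : Fin 6 → Matrix (Fin 2) (Fin 2) ℝ) (hS : ∀ l, (S l).IsSymm)
    (h00 : (S 0) 0 0 ≠ 0) (h01 : (S 0) 0 1 = 0) (h11 : ∀ l : Fin 6, l ≤ 2 → (S l) 1 1 = 0)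
    (s : ℝ) (a : Fin 18 → ℝ)
    (hchain : AltChain (∑ l, (X : ℝ[X]) ^ d l • (S l).map C).det 17 s a) :
    ∃ S' : Fin 6 → Matrix (Fin 2) (Fin 2) ℝ, (∀ l, (S' l).IsSymm) ∧
      20 ≤ ((∑ l, (X : ℝ[X]) ^ d l • (S' l).map C).det.roots.toFinset.filter (fun t => 0 < t)).card := by
  have hlow : ∀ k ≤ d 2, (pencil2 d S).det.coeff k = 0 := by
    intro k hk
    exact boundaryF0_coeff_eq_zero d hd S hS h01 h11 k (lt_of_le_of_lt hk (hd (by decide))) (by omega)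
  obtain ⟨ψ, hψ⟩ := lift_three_on_support d hd hd0 S h00 hlow 17 s a hchain
  exact ⟨fun l => S l + ψ l • E22, pencil2_perturb_isSymm S hS ψ, hψ⟩

end Summit.ValiantsHypothesis.ValiantsHypothesis.Theorems.LacunarySymmetroidMatrixDescartes.Census
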